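import Literature.AlgebraicGeometry.Resolution.LogRegularScheme
import Mathlib.AlgebraicGeometry.Morphisms.Etale
import Mathlib.AlgebraicGeometry.Morphisms.UniversallyOpen
import Mathlib.AlgebraicGeometry.Pullbacks
import Mathlib.AlgebraicGeometry.PullbackCarrier
import HarnessLib

/-!
# Logarithmically regular schemes with charts on the étale site (Nizioł 2006, §2)

Topic: `Literature/AlgebraicGeometry/Resolution`. The étale-site companion of
`LogRegularScheme.lean` (definition request `defn-LogRegularScheme`, "etale version, Niziol2006 §2
/ Kato (1.5) on `X_ét`"): the charts live on finitely many étale `X`-schemes `U_i → X` (jointly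
surjective) instead of Zariski opens, and the compatibility of two charts is asked at the points of
the fibre products `U_i ×_X U_j`. This is the generality of toroidal embeddings WITH
self-intersection (Kato 1994 (1.8)) and of Nizioł's resolution theorems (2006, Cor. 5.7, Thm. 5.10).

## Sources (text read)

* [Niziol2006] W. Nizioł, *Toric singularities: log-blow-ups and global resolutions*,
  J. Algebraic Geom. 15 (2006) 1–29 ("Throughout the paper, unless otherwise stated,
  log-structures are defined using the étale topology. An fs log-scheme is a log-scheme whose
  log-structure is fine with saturated stalks. We will assume all the schemes to be locally
  noetherian."): Def. 2.2 (log regular at `x`: `𝒪_{X,x}/I_x𝒪_{X,x}` regular and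
  `dim 𝒪_{X,x} = dim (𝒪_{X,x}/I_x 𝒪_{X,x}) + rank_ℤ (M^{gp}_X/𝒪^×_X)_x`,
  `I_x = M_{X,x} ∖ 𝒪^×_{X,x}`);
  Lemma 2.3 (for an fs log scheme with a chart `P_X → M_X`, log regularity at `x` is Kato's Zariski
  log regularity of `(X, M_X^{Zar})`, `M_X^{Zar}` the Zariski log structure of `P → Γ(X, 𝒪_X)`);
  Lemma 2.4 (`M_X^{Zar} ≅ ε_* M_X`); Prop. 2.6 (for `(X, M_X)` log regular, `X_tr` is dense open and
  `M_X = 𝒪_X ∩ j_* 𝒪^×_{X_tr}` — the étale (11.6)); §4 (log blow-ups: blow up, then saturate;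
  Prop. 4.3: for log regular `(X, M_X)` the log blow-up at `J` is the normalisation of the blow-up
  of `J𝒪_X`; Thm. 4.7: on a Zariski log regular scheme the log blow-up of `J_f` is Kato's base
  change `(X, M_X) ×_{F(X)} F(X)_f` by the subdivision); Cor. 5.7 ("Any log-regular scheme
  `(X, M_X)` can be weakly desingularized by a log-blow-up", i.e. a log blow-up
  `π : (Y, M_Y) → (X, M_X)` with `Y` classically regular, §5.2); Thm. 5.10 ("Any log-regular
  scheme `(X, M_X)` can be desingularized by a log-blow-up": moreover an isomorphism over `X_reg`,
  §5.3).
* [Kato1994] K. Kato, *Toric singularities*, Amer. J. Math. 116 (1994): (1.5), (1.8), Def. (2.1),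
  (8.2) with (3.1) (log smooth over log regular is log regular), (10.3).

## Rendering

`EtaleLogAtlas X`: a finite index type; étale morphisms `map i : U i ⟶ X` (Mathlib
`AlgebraicGeometry.Etale`) which are jointly surjective on points; fs monoids `P i ⊆ ℤ^{rk i}` in
the normal form of `LogAtlas` (finitely generated, saturated, spanning); charts
`chart i : P i → (Γ(U i, 𝒪_{U i}), ·)`; and compatibility: at every point `w` of
`U i ×_X U j` the two pulled-back charts generate the same submonoid of `𝒪_{U i ×_X U j, w}` up to
units (`chart_compatible`). As in the Zariski file this is implied by the agreement
`pr₁^*(P i)ᵃ ≅ pr₂^*(P j)ᵃ` of the pulled-back (étale) log structures (both have the Zariski chart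
`P i`, resp. `P j`, on `U i ×_X U j`, so their Zariski restrictions are the Zariski associated log
structures, Nizioł Lemma 2.4, whose stalk at `w` has image `𝒪^×·φ_i(P i)` in `𝒪_w`), and is
equivalent to it for log structures injecting into `𝒪` — all log regular ones by Nizioł Prop. 2.6
(a log structure with a Zariski chart is determined by its Zariski restriction, `M = ε^* ε_* M`).

`EtaleLogAtlas.IsLogRegular 𝒜`: `X` locally Noetherian and, at every point `u` of every `U i`,
Kato's (2.1) for the chart through the (Zariski) local ring `𝒪_{U i, u}`
(`LogChart.IsLogRegularLocal`). By Nizioł Lemma 2.3 (applied on `U i` with its global chart) this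
is log regularity of `(U i, (P i)ᵃ)` at `u` in the sense of Def. 2.2, and log regularity of an étale
fs log scheme `(X, M)` at `x` is equivalent to that of `(U, M|_U)` at any `u ↦ x` for `U → X` étale
(`𝒪_{X,x} → 𝒪_{U,u}` is an essentially étale local homomorphism with the same characteristic monoid:
regularity of `𝒪/I` and the two dimensions are unchanged; cf. Kato (8.2) and the first lines of the
proof of Nizioł Prop. 2.6, "the log-scheme `(T, M_T)` is log-regular (the map `T → U_i` being
étale)").

**Faithfulness** (as in the Zariski file): `𝒜.IsLogRegular` holds iff the `(U i, P i, chart i)`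
are étale-local fs charts of an fs log structure `M` on `X_ét` with `(X, M)` log regular
(Nizioł Def. 2.2) — given `IsLogRegular`, each `(U i, (P i)ᵃ)` is log regular, so `(P i)ᵃ ↪ 𝒪`
(Prop. 2.6), the compatibility identifies the restrictions to `U i ×_X U j` as the same subsheaf of
`𝒪`, and subsheaves of `𝒪_{X_ét}` given on an étale cover with equal overlaps glue (descent for
subsheaves) to `M ⊆ 𝒪_{X_ét}`, `M ⊇ 𝒪^×`, with `M|_{U i} = (P i)ᵃ`; conversely charts of one `M`
are compatible and log regularity passes to the `U i`. For `X` quasi-compact finitely many charts of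
the normal form are no restriction (étale maps are open; Kato (1.6) / Nizioł Prop. 2.5 give charts
by `M_x̄/𝒪^×` with free group completion).

## API (all proved)

* `LogAtlas.toEtale` (a Zariski atlas is an étale atlas: `U i ↪ X` open immersions),
  `LogAtlas.isLogRegular_toEtale_iff`, `Scheme.IsLogRegular.isLogRegularEtale`.
* `EtaleLogAtlas.trivialLocus`, `mem_trivialLocus_iff` (independence of the étale point and chart
  over `x`, from compatibility via a point of `U i ×_X U j` over `(u, v)`), `isOpen_trivialLocus`
  (étale morphisms are open), `EtaleLogAtlas.reindex`, `Scheme.IsLogRegularEtale`.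
* The named fact `Niziol2006_logRegularScheme_hasResolution` (below) implies the Zariski one,
  `Kato1994_logRegularScheme_hasResolution` (`Niziol2006_logRegularScheme_hasResolution.zariski`).

## The named fact (ONE, D-0014)

`Niziol2006_logRegularScheme_hasResolution`: Nizioł 2006 Cor. 5.7 (with Thm. 5.10): a
(quasi-compact) log regular scheme with étale charts admits a resolution of singularities in the
weak sense of the tree, `Scheme.HasResolution X` — the resolving log blow-up `π : Y → X` is proper
(§4: a blow-up followed by the finite saturation; Prop. 4.3), `Y` is regular (Cor. 5.7), and `π` is
birational in the tree's sense: an isomorphism over the locus of triviality `X_tr` (there the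
blown-up ideal is the unit ideal), which is dense open (Prop. 2.6) with preimage `Y_tr` dense open
in the log regular `Y` (Thm. 4.7 with Kato (10.3), étale locally; Prop. 2.6).

## What is NOT here

Log structures as sheaves on `X_ét`, geometric points / strict Henselisations (the predicate is
phrased with the Zariski local rings of the étale charts, justified above), monodromy, log
blow-ups, the regular locus `X_reg` and the isomorphism of Thm. 5.10 over it, Gabber's refinements
(Illusie–Laszlo–Orgogozo 2014). No theorem of Nizioł's is proved here.
-/

noncomputable section

open AlgebraicGeometry CategoryTheory CategoryTheory.Limits TopologicalSpace Opposite

namespace Literature.AlgebraicGeometry.Resolution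

universe w w' u

/-! ## Two germ computations -/

section Germs

variable {X Y : Scheme.{u}}

/-- The germ at `x` of `f.appLE U V e s` is the stalk map of `f` applied to the germ of `s` at
`f x`. [folklore] -/
theorem germ_appLE_eq_stalkMap (f : X ⟶ Y) (U : Y.Opens) (V : X.Opens) (e : V ≤ f ⁻¹ᵁ U)
    (x : X) (hx : x ∈ V) (s : Γ(Y, U)) :
    X.presheaf.germ V x hx (f.appLE U V e s) =
      (f.stalkMap x).hom (Y.presheaf.germ U (f x) (e hx) s) := by
  rw [Scheme.Hom.germ_stalkMap_apply, Scheme.Hom.appLE, CommRingCat.comp_apply,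
    TopCat.Presheaf.germ_res_apply]

/-- Stalk maps of equal morphisms agree on germs. [folklore] -/
theorem stalkMap_germ_congr_hom {f g : X ⟶ Y} (hfg : f = g) (U : Y.Opens) (x : X)
    (hx : f x ∈ U) (hx' : g x ∈ U) (s : Γ(Y, U)) :
    (f.stalkMap x).hom (Y.presheaf.germ U (f x) hx s) =
      (g.stalkMap x).hom (Y.presheaf.germ U (g x) hx' s) := by
  subst hfg
  rfl

/-- Germs of sections transported to an `X`-scheme `a : W → U ⊆ X` through the open subscheme `U`:
the germ at `w` of `a^♯(s|_U)` is the stalk map of `a ≫ U.ι` applied to the germ of `s`.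
[folklore] -/
theorem germ_appTop_appLE_ι (U : X.Opens) {W : Scheme.{u}} (a : W ⟶ U) (w : W) (s : Γ(X, U)) :
    W.presheaf.germ ⊤ w trivial (a.appTop (U.ι.appLE U ⊤ U.ι_preimage_self.ge s)) =
      ((a ≫ U.ι).stalkMap w).hom (X.presheaf.germ U ((a ≫ U.ι) w) (a w).2 s) := by
  have happ : a.appTop (U.ι.appLE U ⊤ U.ι_preimage_self.ge s) =
      (a ≫ U.ι).appLE U ⊤ (fun x _ => (a x).2) s := by
    have h := Scheme.Hom.appLE_comp_appLE a U.ι U ⊤ (a ⁻¹ᵁ ⊤) U.ι_preimage_self.ge le_rfl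
    rw [Scheme.Hom.appLE_eq_app] at h
    have h' := congrArg (fun φ => φ.hom s) h
    simp only [CommRingCat.hom_comp, RingHom.comp_apply] at h'
    exact h'
  rw [happ]
  exact germ_appLE_eq_stalkMap (a ≫ U.ι) U ⊤ _ w trivial s

end Germs

/-! ## Atlases of fs charts on the étale site -/

/-- An **atlas of fs étale charts** on a scheme `X` (Kato's condition (S) on `X_ét`, Nizioł 2006
§2.1, with finitely many charts in the normal form of `LogAtlas`): a finite index type `ι`; étale
morphisms `map i : U i ⟶ X`, jointly surjective; submonoids `P i ⊆ ℤ^{rk i}` finitely generated,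
saturated and spanning; monoid homomorphisms `chart i : P i → (Γ(U i, 𝒪), ·)`; and the
compatibility on overlaps: at each point `w` of `U i ×_X U j`, every `pr₁^♯ φ_i(p)` is a unit
multiple in `𝒪_{U i ×_X U j, w}` of some `pr₂^♯ φ_j(q)` (stated for all ordered pairs `(i, j)`),
i.e. the pulled-back charts generate the same submonoid of the local ring up to units — implied by,
and for log structures injecting into `𝒪` (all log regular ones, Nizioł Prop. 2.6) equivalent to,
`pr₁^*(P i)ᵃ ≅ pr₂^*(P j)ᵃ` (module docstring). A Zariski atlas is the case of open immersions
(`LogAtlas.toEtale`). [cite: Niziol2006, §2.1 and Def. 2.2] [cite: Kato1994, (1.5) and (1.8)] -/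
structure EtaleLogAtlas (X : Scheme.{u}) where
  /-- the (finite) index type of the charts -/
  ι : Type w
  /-- there are finitely many charts -/
  [finite_index : Finite ι]
  /-- the domain of the `i`-th chart, an étale `X`-scheme -/
  U : ι → Scheme.{u}
  /-- the structure morphism `U i ⟶ X` -/
  map : (i : ι) → U i ⟶ X
  /-- the structure morphisms are étale -/
  etale : ∀ i, Etale (map i)
  /-- the `U i` cover `X` (jointly surjective) -/
  exists_eq : ∀ x : X, ∃ (i : ι) (u : U i), map i u = x
  /-- the rank `n_i` of the lattice `ℤ^{n_i} = (P i)ᵍᵖ` -/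
  rk : ι → ℕ
  /-- the chart monoid `P i ⊆ ℤ^{n_i}` -/
  P : (i : ι) → AddSubmonoid (Fin (rk i) → ℤ)
  /-- `P i` is finitely generated -/
  fg : ∀ i, (P i).FG
  /-- `P i` is saturated in `ℤ^{n_i}` -/
  saturated : ∀ i, (P i).NSMulSaturated
  /-- `P i` spans `ℤ^{n_i}` as a group -/
  span_eq_top : ∀ i, Submodule.span ℤ (P i : Set (Fin (rk i) → ℤ)) = ⊤
  /-- the chart `φ_i : P i → (Γ(U i, 𝒪_{U i}), ·)` -/
  chart : (i : ι) → Multiplicative (P i) →* Γ(U i, ⊤)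
  /-- compatibility on `U i ×_X U j`: the pulled-back charts generate the same submonoid of the
  local ring at every point, up to units -/
  chart_compatible : ∀ (i j : ι) (w : ↥(pullback (map i) (map j))) (p : P i), ∃ q : P j,
    Associated
      ((pullback (map i) (map j)).presheaf.germ ⊤ w trivial
        ((pullback.fst (map i) (map j)).appTop (chart i (Multiplicative.ofAdd p))))
      ((pullback (map i) (map j)).presheaf.germ ⊤ w trivial
        ((pullback.snd (map i) (map j)).appTop (chart j (Multiplicative.ofAdd q))))

namespace EtaleLogAtlas

variable {X : Scheme.{u}} (𝒜 : EtaleLogAtlas.{w} X)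

/-- The index type of an étale atlas is finite (structure field as an instance; about the new
structure only). [cite: Niziol2006, §2.1] -/
instance finite_ι : Finite 𝒜.ι :=
  𝒜.finite_index

/-- The chart domains are étale over `X` (structure field as an instance; about the new
structure only). [cite: Niziol2006, §2.1] -/
instance etale_map (i : 𝒜.ι) : Etale (𝒜.map i) :=
  𝒜.etale i

/-- Saturation in the explicit form. [cite: Kato1994, (1.1)] -/
theorem saturated' (i : 𝒜.ι) (v : Fin (𝒜.rk i) → ℤ) (k : ℕ) (hk : 0 < k) (hv : k • v ∈ 𝒜.P i) :
    v ∈ 𝒜.P i :=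
  (𝒜.saturated i hv).resolve_left (Nat.pos_iff_ne_zero.1 hk)

/-- The chart at a point `u` of `U i`: `φ_{i,u} : P i → (𝒪_{U i, u}, ·)`.
[cite: Niziol2006, Def. 2.2 and Lemma 2.3] -/
def stalkChart (i : 𝒜.ι) (u : 𝒜.U i) :
    Multiplicative (𝒜.P i) →* ((𝒜.U i).presheaf.stalk u : Type u) :=
  ((𝒜.U i).presheaf.germ ⊤ u trivial).hom.toMonoidHom.comp (𝒜.chart i)

/-- Unfolding `stalkChart` (`rfl`). [cite: Niziol2006, Def. 2.2] -/
@[simp] theorem stalkChart_apply (i : 𝒜.ι) (u : 𝒜.U i) (p : Multiplicative (𝒜.P i)) :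
    𝒜.stalkChart i u p = (𝒜.U i).presheaf.germ ⊤ u trivial (𝒜.chart i p) :=
  rfl

/-- **Logarithmic regularity** of the étale fs log scheme presented by `𝒜` (Nizioł 2006, Def. 2.2
at every point, via Lemma 2.3 on each chart): `X` is locally Noetherian and at every point `u` of
every chart domain `U i` the chart through the local ring `𝒪_{U i, u}` satisfies Kato's (2.1)
(`LogChart.IsLogRegularLocal`). [cite: Niziol2006, Def. 2.2 and Lemma 2.3]
[cite: Kato1994, Def. (2.1)] -/
structure IsLogRegular : Prop where
  /-- `X` is locally Noetherian -/
  isLocallyNoetherian : IsLocallyNoetherian X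
  /-- Kato's (2.1) at every point of every chart domain -/
  isLogRegularLocal : ∀ (i : 𝒜.ι) (u : 𝒜.U i),
    LogChart.IsLogRegularLocal (𝒜.P i) (𝒜.stalkChart i u)

/-! ### The open set of triviality -/

/-- The **locus of triviality** `X_tr ⊆ X`: the points over which some (equivalently every,
`mem_trivialLocus_iff`) chart is by units, i.e. `M_x̄ = 𝒪^×`. [cite: Niziol2006, Prop. 2.6] -/
def trivialLocus : Set X :=
  {x | ∃ (i : 𝒜.ι) (u : 𝒜.U i), 𝒜.map i u = x ∧
    ∀ p : 𝒜.P i, IsUnit (𝒜.stalkChart i u (Multiplicative.ofAdd p))}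

/-- The germ at `w ∈ U i ×_X U j` of the first pulled-back chart is the stalk map of `pr₁` applied
to the chart at `pr₁ w`. [folklore] -/
theorem germ_fst_appTop (i j : 𝒜.ι) (w : ↥(pullback (𝒜.map i) (𝒜.map j)))
    (p : Multiplicative (𝒜.P i)) :
    (pullback (𝒜.map i) (𝒜.map j)).presheaf.germ ⊤ w trivial
        ((pullback.fst (𝒜.map i) (𝒜.map j)).appTop (𝒜.chart i p)) =
      ((pullback.fst (𝒜.map i) (𝒜.map j)).stalkMap w).hom
        (𝒜.stalkChart i (pullback.fst (𝒜.map i) (𝒜.map j) w) p) :=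
  (Scheme.Hom.germ_stalkMap_apply _ ⊤ w trivial _).symm

/-- The same for the second projection. [folklore] -/
theorem germ_snd_appTop (i j : 𝒜.ι) (w : ↥(pullback (𝒜.map i) (𝒜.map j)))
    (q : Multiplicative (𝒜.P j)) :
    (pullback (𝒜.map i) (𝒜.map j)).presheaf.germ ⊤ w trivial
        ((pullback.snd (𝒜.map i) (𝒜.map j)).appTop (𝒜.chart j q)) =
      ((pullback.snd (𝒜.map i) (𝒜.map j)).stalkMap w).hom
        (𝒜.stalkChart j (pullback.snd (𝒜.map i) (𝒜.map j) w) q) :=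
  (Scheme.Hom.germ_stalkMap_apply _ ⊤ w trivial _).symm

/-- If the chart `j` is by units at `v` then every chart `i` is by units at every `u` over the
same point of `X` (compatibility at a point of `U i ×_X U j` over `(u, v)`; stalk maps are local
homomorphisms). [folklore] -/
theorem forall_isUnit_of_forall_isUnit {i j : 𝒜.ι} {u : 𝒜.U i} {v : 𝒜.U j}
    (h : 𝒜.map i u = 𝒜.map j v)
    (hv : ∀ q : 𝒜.P j, IsUnit (𝒜.stalkChart j v (Multiplicative.ofAdd q))) (p : 𝒜.P i) :
    IsUnit (𝒜.stalkChart i u (Multiplicative.ofAdd p)) := by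
  obtain ⟨w, hwu, hwv⟩ := Scheme.Pullback.exists_preimage_pullback u v h
  subst hwu
  subst hwv
  obtain ⟨q, hq⟩ := 𝒜.chart_compatible i j w p
  rw [germ_fst_appTop, germ_snd_appTop] at hq
  exact (isUnit_map_iff ((pullback.fst (𝒜.map i) (𝒜.map j)).stalkMap w).hom _).1
    (hq.isUnit_iff.2 ((hv q).map _))

/-- Independence of triviality of the chart and of the point over `x`. [folklore] -/
theorem forall_isUnit_iff {i j : 𝒜.ι} {u : 𝒜.U i} {v : 𝒜.U j} (h : 𝒜.map i u = 𝒜.map j v) :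
    (∀ p : 𝒜.P i, IsUnit (𝒜.stalkChart i u (Multiplicative.ofAdd p))) ↔
      ∀ q : 𝒜.P j, IsUnit (𝒜.stalkChart j v (Multiplicative.ofAdd q)) :=
  ⟨fun hu => 𝒜.forall_isUnit_of_forall_isUnit h.symm hu,
    fun hv => 𝒜.forall_isUnit_of_forall_isUnit h hv⟩

/-- `x ∈ X_tr` iff EVERY chart is by units at EVERY point over `x`. [folklore] -/
theorem mem_trivialLocus_iff (x : X) :
    x ∈ 𝒜.trivialLocus ↔ ∀ (i : 𝒜.ι) (u : 𝒜.U i), 𝒜.map i u = x →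
      ∀ p : 𝒜.P i, IsUnit (𝒜.stalkChart i u (Multiplicative.ofAdd p)) := by
  constructor
  · rintro ⟨i, u, rfl, hu⟩ j v hv
    exact (𝒜.forall_isUnit_iff hv.symm).1 hu
  · intro h
    obtain ⟨i, u, hu⟩ := 𝒜.exists_eq x
    exact ⟨i, u, hu, h i u hu⟩

/-- The part of the locus of triviality seen by one chart, upstairs: an open subset of `U i`
(`⋂_{g ∈ S} D(φ_i g)` for a finite generating set `S` of `P i`). [cite: Niziol2006, Prop. 2.6] -/
theorem isOpen_setOf_forall_isUnit (i : 𝒜.ι) :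
    IsOpen {u : 𝒜.U i | ∀ p : 𝒜.P i, IsUnit (𝒜.stalkChart i u (Multiplicative.ofAdd p))} := by
  obtain ⟨S, hS⟩ := AddMonoid.fg_def.1 ((AddMonoid.fg_iff_addSubmonoid_fg _).2 (𝒜.fg i))
  have heq : {u : 𝒜.U i | ∀ p : 𝒜.P i, IsUnit (𝒜.stalkChart i u (Multiplicative.ofAdd p))} =
      ⋂ g ∈ S, ((𝒜.U i).basicOpen (𝒜.chart i (Multiplicative.ofAdd g)) : Set (𝒜.U i)) := by
    ext u
    simp only [Set.mem_setOf_eq, Set.mem_iInter, SetLike.mem_coe]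
    constructor
    · intro h g _
      exact ((𝒜.U i).mem_basicOpen_top _ u).2 (h g)
    · intro h p
      have hp : p ∈ AddSubmonoid.closure (S : Set (𝒜.P i)) := by
        rw [hS]
        exact AddSubmonoid.mem_top p
      induction hp using AddSubmonoid.closure_induction with
      | mem g hg => exact ((𝒜.U i).mem_basicOpen_top _ u).1 (h g hg)
      | zero =>
        rw [ofAdd_zero, map_one]
        exact isUnit_one
      | add a b _ _ ha hb =>
        rw [ofAdd_add, map_mul]
        exact ha.mul hb
  rw [heq]
  exact isOpen_biInter_finset fun g _ => ((𝒜.U i).basicOpen _).isOpen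

/-- **The locus of triviality is open**: it is the union of the images of the open pieces
upstairs under the open (étale) maps `U i → X`. [cite: Niziol2006, Prop. 2.6] -/
theorem isOpen_trivialLocus : IsOpen 𝒜.trivialLocus := by
  have heq : 𝒜.trivialLocus = ⋃ i, 𝒜.map i ''
      {u : 𝒜.U i | ∀ p : 𝒜.P i, IsUnit (𝒜.stalkChart i u (Multiplicative.ofAdd p))} := by
    ext x
    simp only [trivialLocus, Set.mem_setOf_eq, Set.mem_iUnion, Set.mem_image]
    constructor
    · rintro ⟨i, u, hu, h⟩
      exact ⟨i, u, h, hu⟩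
    · rintro ⟨i, u, h, hu⟩
      exact ⟨i, u, hu, h⟩
  rw [heq]
  exact isOpen_iUnion fun i => (𝒜.map i).isOpenMap _ (𝒜.isOpen_setOf_forall_isUnit i)

/-- On the locus of triviality the chart domains are regular: if `𝒜` is log regular and the chart
`i` is by units at `u`, then `𝒪_{U i, u}` is a regular local ring (Kato (2.2)(1) upstairs).
[cite: Kato1994, (2.2)(1)] -/
theorem IsLogRegular.isRegularLocalRing_of_forall_isUnit {𝒜 : EtaleLogAtlas.{w} X}
    (h : 𝒜.IsLogRegular) {i : 𝒜.ι} {u : 𝒜.U i}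
    (hu : ∀ p : 𝒜.P i, IsUnit (𝒜.stalkChart i u (Multiplicative.ofAdd p))) :
    IsRegularLocalRing ((𝒜.U i).presheaf.stalk u) :=
  (LogChart.isLogRegularLocal_iff_of_forall_isUnit (𝒜.P i) (𝒜.span_eq_top i) _ hu).1
    (h.isLogRegularLocal i u)

/-! ### Change of index type -/

/-- Reindex an étale atlas along an equivalence of (finite) index types. [folklore] -/
def reindex {κ : Type w'} (e : κ ≃ 𝒜.ι) : EtaleLogAtlas.{w'} X where
  ι := κ
  finite_index := Finite.of_equiv _ e.symm
  U k := 𝒜.U (e k)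
  map k := 𝒜.map (e k)
  etale k := 𝒜.etale (e k)
  exists_eq x := by
    obtain ⟨i, u, hu⟩ := 𝒜.exists_eq x
    obtain ⟨k, rfl⟩ := e.surjective i
    exact ⟨k, u, hu⟩
  rk k := 𝒜.rk (e k)
  P k := 𝒜.P (e k)
  fg k := 𝒜.fg (e k)
  saturated k := 𝒜.saturated (e k)
  span_eq_top k := 𝒜.span_eq_top (e k)
  chart k := 𝒜.chart (e k)
  chart_compatible k l w p := 𝒜.chart_compatible (e k) (e l) w p

/-- Log regularity is insensitive to reindexing. [folklore] -/
theorem IsLogRegular.reindex {𝒜 : EtaleLogAtlas.{w} X} (h : 𝒜.IsLogRegular) {κ : Type w'}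
    (e : κ ≃ 𝒜.ι) : (𝒜.reindex e).IsLogRegular :=
  ⟨h.isLocallyNoetherian, fun k u => h.isLogRegularLocal (e k) u⟩

end EtaleLogAtlas

/-! ## A Zariski atlas is an étale atlas -/

namespace LogAtlas

variable {X : Scheme.{u}} (𝒜 : LogAtlas.{w} X)

/-- A **Zariski atlas is an étale atlas**: the chart domains `U i ⊆ X` with their open immersions
`U i ↪ X` (étale), the same monoids, and the charts restricted to `Γ(U i, 𝒪_{U i}) = Γ(X, U i)`.
[cite: Niziol2006, §2.1] [cite: Kato1994, (1.8)] -/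
def toEtale : EtaleLogAtlas.{w} X where
  ι := 𝒜.ι
  U i := 𝒜.U i
  map i := (𝒜.U i).ι
  etale _ := inferInstance
  exists_eq x := by
    obtain ⟨i, hx⟩ := 𝒜.exists_mem x
    exact ⟨i, ⟨x, hx⟩, rfl⟩
  rk := 𝒜.rk
  P := 𝒜.P
  fg := 𝒜.fg
  saturated := 𝒜.saturated
  span_eq_top := 𝒜.span_eq_top
  chart i := ((𝒜.U i).ι.appLE (𝒜.U i) ⊤ (𝒜.U i).ι_preimage_self.ge).hom.toMonoidHom.comp
    (𝒜.chart i)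
  chart_compatible i j w p := by
    have hcond : pullback.fst (𝒜.U i).ι (𝒜.U j).ι ≫ (𝒜.U i).ι =
        pullback.snd (𝒜.U i).ι (𝒜.U j).ι ≫ (𝒜.U j).ι := pullback.condition
    have hj : (pullback.fst (𝒜.U i).ι (𝒜.U j).ι ≫ (𝒜.U i).ι) w ∈ 𝒜.U j := by
      rw [hcond]
      exact (pullback.snd (𝒜.U i).ι (𝒜.U j).ι w).2
    obtain ⟨q, hq⟩ := 𝒜.chart_compatible i j _
      (pullback.fst (𝒜.U i).ι (𝒜.U j).ι w).2 hj p
    refine ⟨q, ?_⟩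
    have e1 := germ_appTop_appLE_ι (𝒜.U i) (pullback.fst (𝒜.U i).ι (𝒜.U j).ι) w
      (𝒜.chart i (Multiplicative.ofAdd p))
    have e2 := germ_appTop_appLE_ι (𝒜.U j) (pullback.snd (𝒜.U i).ι (𝒜.U j).ι) w
      (𝒜.chart j (Multiplicative.ofAdd q))
    rw [stalkMap_germ_congr_hom hcond.symm (𝒜.U j) w _ hj] at e2
    simp only [MonoidHom.coe_comp, Function.comp_apply, RingHom.toMonoidHom_eq_coe,
      MonoidHom.coe_coe]
    rw [e1, e2]
    exact hq.map _

/-- The charts of `𝒜.toEtale` at a point `u` of `U i` are those of `𝒜` at `u ∈ X` followed by the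
(invertible) stalk map of the open immersion `U i ↪ X`. [folklore] -/
theorem stalkChart_toEtale (i : 𝒜.ι) (u : ↥(𝒜.U i)) :
    𝒜.toEtale.stalkChart i u =
      ((𝒜.U i).ι.stalkMap u).hom.toMonoidHom.comp (𝒜.stalkChart i u.1 u.2) := by
  refine MonoidHom.ext fun p => ?_
  exact germ_appLE_eq_stalkMap (𝒜.U i).ι (𝒜.U i) ⊤ (𝒜.U i).ι_preimage_self.ge u trivial _

/-- **A Zariski atlas is log regular iff it is log regular as an étale atlas** (the stalks of
`U i` and of `X` agree). [cite: Niziol2006, Lemma 2.3] -/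
theorem isLogRegular_toEtale_iff : 𝒜.toEtale.IsLogRegular ↔ 𝒜.IsLogRegular := by
  have key : ∀ (i : 𝒜.ι) (u : ↥(𝒜.U i)),
      LogChart.IsLogRegularLocal (𝒜.P i) (𝒜.toEtale.stalkChart i u) ↔
        LogChart.IsLogRegularLocal (𝒜.P i) (𝒜.stalkChart i u.1 u.2) := by
    intro i u
    rw [stalkChart_toEtale]
    exact LogChart.isLogRegularLocal_comp_equiv (𝒜.P i) (𝒜.stalkChart i u.1 u.2)
      (asIso ((𝒜.U i).ι.stalkMap u)).commRingCatIsoToRingEquiv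
  constructor
  · intro h
    exact ⟨h.isLocallyNoetherian, fun i x hx => (key i ⟨x, hx⟩).1 (h.isLogRegularLocal i ⟨x, hx⟩)⟩
  · intro h
    exact ⟨h.isLocallyNoetherian, fun i u => (key i u).2 (h.isLogRegularLocal i u.1 u.2)⟩

/-- The locus of triviality of `𝒜.toEtale` is that of `𝒜`. [folklore] -/
theorem trivialLocus_toEtale : 𝒜.toEtale.trivialLocus = 𝒜.trivialLocus := by
  have key : ∀ (i : 𝒜.ι) (u : ↥(𝒜.U i)) (p : 𝒜.P i),
      IsUnit (𝒜.toEtale.stalkChart i u (Multiplicative.ofAdd p)) ↔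
        IsUnit (𝒜.stalkChart i u.1 u.2 (Multiplicative.ofAdd p)) := by
    intro i u p
    rw [stalkChart_toEtale]
    exact isUnit_map_iff ((𝒜.U i).ι.stalkMap u).hom _
  ext x
  constructor
  · rintro ⟨i, u, rfl, hu⟩
    exact ⟨i, u.2, fun p => (key i u p).1 (hu p)⟩
  · rintro ⟨i, hx, hu⟩
    exact ⟨i, ⟨x, hx⟩, rfl, fun p => (key i ⟨x, hx⟩ p).2 (hu p)⟩

end LogAtlas

/-! ## Log regular schemes (étale charts) -/

/-- `X` **underlies a log regular scheme with étale charts**: SOME finite atlas of fs étale charts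
on `X` is log regular (Nizioł 2006, Def. 2.2). [cite: Niziol2006, Def. 2.2] -/
def Scheme.IsLogRegularEtale (X : Scheme.{u}) : Prop :=
  ∃ 𝒜 : EtaleLogAtlas.{u} X, 𝒜.IsLogRegular

/-- A log regular étale atlas with any (finite) index type witnesses `Scheme.IsLogRegularEtale`.
[folklore] -/
theorem EtaleLogAtlas.IsLogRegular.isLogRegularEtale_scheme {X : Scheme.{u}}
    {𝒜 : EtaleLogAtlas.{w} X} (h : 𝒜.IsLogRegular) : Scheme.IsLogRegularEtale X :=
  ⟨𝒜.reindex (Equiv.ulift.trans (Finite.equivFin 𝒜.ι).symm), h.reindex _⟩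

/-- Zariski log regular ⇒ étale log regular. [cite: Niziol2006, Lemma 2.3] -/
theorem Scheme.IsLogRegular.isLogRegularEtale {X : Scheme.{u}} (h : Scheme.IsLogRegular X) :
    Scheme.IsLogRegularEtale X := by
  obtain ⟨𝒜, h𝒜⟩ := h
  exact ⟨𝒜.toEtale, (𝒜.isLogRegular_toEtale_iff).2 h𝒜⟩

/-! ## Named fact: resolution of log regular schemes with étale charts (Nizioł 2006) -/

/-- NAMED FACT — **Nizioł 2006, Cor. 5.7** ("Any log-regular scheme `(X, M_X)` can be weakly
desingularized by a log-blow-up": a log blow-up `π : (Y, M_Y) → (X, M_X)` with `Y` regular in the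
classical sense, §5.2; refined by Thm. 5.10, an isomorphism over the regular locus), for fs log
structures on the ÉTALE site, vendored in the weak form of the tree: for a quasi-compact scheme `X`
with a log regular atlas of fs étale charts `𝒜` (`EtaleLogAtlas.IsLogRegular`: `X` locally
Noetherian, Kato's (2.1) / Nizioł Def. 2.2 at every point of every chart), `X` has a resolution of
singularities, `Scheme.HasResolution X` — `π` is proper (§4: the log blow-up is a blow-up of a
coherent ideal followed by the finite saturation; Prop. 4.3), `Y` is regular (Cor. 5.7), and `π`
is birational in the tree's sense (an isomorphism over the locus of triviality `X_tr`, where the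
blown-up ideal of `M_X` is the unit ideal; `X_tr` is dense open by Prop. 2.6, and its preimage
`Y_tr` is dense open in the log regular `Y`, Thm. 4.7 with Kato (10.3) étale locally and Prop. 2.6).
The quasi-compactness hypothesis is not needed by Nizioł and only weakens the fact. The Zariski
form `Kato1994_logRegularScheme_hasResolution` follows
(`Niziol2006_logRegularScheme_hasResolution.zariski`). Users take
`(h : Niziol2006_logRegularScheme_hasResolution)`.
[cite: Niziol2006, Cor. 5.7 and Thm. 5.10, with Prop. 2.6, §4 (Prop. 4.3, Thm. 4.7)]
-- TODO(general form): the resolving morphism is a single log blow-up, projective, an isomorphism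
-- over `X_reg` (Thm. 5.10); Gabber's functorial refinements (Illusie–Laszlo–Orgogozo 2014). -/
def Niziol2006_logRegularScheme_hasResolution : Prop :=
  ∀ (X : Scheme.{u}) (𝒜 : EtaleLogAtlas.{u} X), CompactSpace X → 𝒜.IsLogRegular →
    Scheme.HasResolution X

/-- The fact applied through `Scheme.IsLogRegularEtale`. [cite: Niziol2006, Cor. 5.7] -/
theorem Niziol2006_logRegularScheme_hasResolution.hasResolution
    (h : Niziol2006_logRegularScheme_hasResolution.{u}) {X : Scheme.{u}} [CompactSpace X]
    (hX : Scheme.IsLogRegularEtale X) : Scheme.HasResolution X := by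
  obtain ⟨𝒜, h𝒜⟩ := hX
  exact h X 𝒜 ‹_› h𝒜

/-- **Consistency**: the étale-charts fact implies the Zariski-charts fact
`Kato1994_logRegularScheme_hasResolution` (and hence the one-chart affine fact
`Kato1994_logRegular_hasResolution`). [cite: Niziol2006, Cor. 5.7] -/
theorem Niziol2006_logRegularScheme_hasResolution.zariski
    (h : Niziol2006_logRegularScheme_hasResolution.{u}) :
    Kato1994_logRegularScheme_hasResolution.{u} :=
  fun X 𝒜 hc h𝒜 => h X 𝒜.toEtale hc ((𝒜.isLogRegular_toEtale_iff).2 h𝒜)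

end Literature.AlgebraicGeometry.Resolution

end
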